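import Summits.QuantumFields.YangMills.Theorems.IR.SCFloorConvolutionPositivity
import Summits.QuantumFields.YangMills.Theorems.IR.BetaSlopeFloorRungHaar
import Literature.MathematicalPhysics.QuantumFieldTheory.StrongCouplingActivities
import Literature.MathematicalPhysics.QuantumLattice.LatticeGaugeDLRGibbsProofs
import Mathlib.MeasureTheory.Integral.Prod

/-!
# Strong-coupling floor engine, part 2: the cube integral is a six-fold convolution power

Pooled prover `ym-ir-line-bsf-p1` (crux `IR`, stmt-QuantumFields-19354; director-ym R366 pooled queue), support file for
`FacingPlaquetteCovFloor`.  On a finite product `ι → G` of copies of the Haar probability measure of a compact group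
(the torus link configuration), for a continuous real CLASS function `φ` with `φ(g⁻¹) = φ(g)` and twelve distinct
coordinates carrying the edges of the unit cube between two facing plaquettes, the Haar integral of the product of the
six face observables `∏_{f} φ(hol_f)` (words exactly as `plaquetteHolonomy` writes them) equals `φ^{*6}(1)`
(`integral_cube_eq`), hence is STRICTLY POSITIVE when `φ ≢ 0` (`integral_cube_pos`, from part 1).  Proof: lattice
gauge fixing done as five one-coordinate integrations («gluing»: `∫ ψ₁(gX) ψ₂(g⁻¹Y) dg = (ψ₁ ⋆ ψ₂)(YX)`), in the order
`c₀, c₁, a₁, c₂, b₁` for which every intermediate face word stays a simple loop (checked by free + cyclic reduction),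
then the last word collapses to `1`.  Tools proved here for general use: one-coordinate disintegration of a finite
product Haar integral (`integral_pi_eq_integral_integral_update`), the gluing identity, and centrality/symmetry of
convolution powers.  Group-theory plumbing only — nothing here bears on the Yang–Mills mass gap.
-/

set_option autoImplicit false

noncomputable section

open MeasureTheory Filter Topology Function
open Literature.MathematicalPhysics.QuantumFieldTheory (haarProbability integral_haar_conj_eq)
open Literature.MathematicalPhysics.QuantumLattice

namespace Summit.QuantumFields.YangMills.Cruxes.IR.SCFloor

variable {G : Type*} [Group G] [TopologicalSpace G] [IsTopologicalGroup G] [CompactSpace G]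
  [MeasurableSpace G] [BorelSpace G]

/-! ## §1 Class functions: cyclicity, and stability under convolution -/

omit [TopologicalSpace G] [IsTopologicalGroup G] [CompactSpace G] [MeasurableSpace G] [BorelSpace G] in
/-- A class function is cyclic: `φ (x y) = φ (y x)`. -/
theorem apply_mul_comm_of_central {φ : G → ℝ} (hφz : ∀ g h, φ (h * g * h⁻¹) = φ g) (x y : G) :
    φ (x * y) = φ (y * x) := by
  have := hφz (y * x) x
  rwa [← mul_assoc, mul_inv_cancel_right] at this

/-- The convolution of a central kernel with a central function is central. -/
theorem haarConv_central {k f : G → ℝ} (hk : ∀ g h, k (h * g * h⁻¹) = k g)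
    (hf : ∀ g h, f (h * g * h⁻¹) = f g) (g h : G) : haarConv k f (h * g * h⁻¹) = haarConv k f g := by
  rw [mul_assoc, ← haarConv_comp_mul_left hk, ← haarConv_comp_mul_right]
  simp only [← mul_assoc, hf]

/-- Convolution powers of a central continuous kernel are central. -/
theorem convIter_central {k : G → ℝ} (hk : ∀ g h, k (h * g * h⁻¹) = k g) :
    ∀ n (g h : G), ((haarConv k)^[n] k) (h * g * h⁻¹) = ((haarConv k)^[n] k) g
  | 0, g, h => hk g h
  | n + 1, g, h => by rw [convIter_succ]; exact haarConv_central hk (convIter_central hk n) g h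

/-! ## §2 The gluing identity on `G` -/

/-- **Gluing**: `∫ ψ₁(g X) ψ₂(g⁻¹ Y) dg = (ψ₁ ⋆ ψ₂)(Y X)` for a central `ψ₂` (right translation `g ↦ g X⁻¹`, then
the definition of `haarConv`). -/
theorem integral_mul_glue {ψ₁ ψ₂ : G → ℝ} (hψ₂ : ∀ g h, ψ₂ (h * g * h⁻¹) = ψ₂ g) (X Y : G) :
    ∫ g, ψ₁ (g * X) * ψ₂ (g⁻¹ * Y) ∂haarProbability G = haarConv ψ₁ ψ₂ (Y * X) := by
  rw [haarConv_apply]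
  have h := integral_mul_right_eq_self (μ := haarProbability G)
    (fun h => ψ₁ h * ψ₂ (h⁻¹ * (Y * X))) X
  rw [← h]
  refine integral_congr_ae (Eventually.of_forall fun g => ?_)
  dsimp only
  congr 1
  symm
  calc ψ₂ ((g * X)⁻¹ * (Y * X)) = ψ₂ (X⁻¹ * (g⁻¹ * Y) * X⁻¹⁻¹) := by
        congr 1; simp only [mul_inv_rev, inv_inv, mul_assoc]
    _ = ψ₂ (g⁻¹ * Y) := hψ₂ _ _

/-! ## §3 One-coordinate disintegration of a finite product Haar integral -/

section Pi

variable {ι : Type*} [Fintype ι] [DecidableEq ι] [SecondCountableTopology G]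

/-- **Disintegration along one coordinate**: for a bounded measurable `Φ` on `ι → G`,
`∫ Φ dπ = ∫ (∫ Φ(update U e g) dg) dπ(U)` (`π` the product Haar probability measure).  Proof without product
isomorphisms: average the skew left translation `U ↦ update U e (g · U e)` (which preserves `π`) over `g`, swap
the two integrals, and use right invariance in `g`. -/
theorem integral_pi_eq_integral_integral_update (e : ι) {Φ : (ι → G) → ℝ} (hΦm : Measurable Φ)
    {C : ℝ} (hΦb : ∀ U, |Φ U| ≤ C) :
    ∫ U, Φ U ∂(Measure.pi fun _ : ι => haarProbability G) =
      ∫ U, (∫ g, Φ (update U e g) ∂haarProbability G) ∂(Measure.pi fun _ : ι => haarProbability G) := by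
  set π : Measure (ι → G) := Measure.pi fun _ : ι => haarProbability G with hπ
  -- (1) `∫ Φ = ∫_g ∫_U Φ(update U e (g · U e))`
  have hskew : ∀ g : G, ∫ U, Φ (update U e (g * U e)) ∂π = ∫ U, Φ U ∂π := fun g =>
    BetaSlopeFloor.integral_comp_update_mul (haarProbability G) e (c := fun _ => g) measurable_const
      (fun _ _ => rfl) hΦm
  have h1 : ∫ U, Φ U ∂π = ∫ g, (∫ U, Φ (update U e (g * U e)) ∂π) ∂haarProbability G := by
    simp only [hskew, integral_const, smul_eq_mul, probReal_univ, one_mul]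
  -- (2) swap
  have hF : Measurable (uncurry fun (g : G) (U : ι → G) => Φ (update U e (g * U e))) := by
    refine hΦm.comp ?_
    exact measurable_update'.comp
      (measurable_snd.prodMk ((measurable_fst.mul ((measurable_pi_apply e).comp measurable_snd))))
  have hI : Integrable (uncurry fun (g : G) (U : ι → G) => Φ (update U e (g * U e)))
      ((haarProbability G).prod π) :=
    Integrable.of_bound hF.aestronglyMeasurable C (Eventually.of_forall fun p => by
      rw [Real.norm_eq_abs]; exact hΦb _)
  rw [h1, integral_integral_swap hI]
  -- (3) right invariance in `g`
  refine integral_congr_ae (Eventually.of_forall fun U => ?_)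
  exact integral_mul_right_eq_self (μ := haarProbability G) (fun g => Φ (update U e g)) (U e)


/-- **One gluing step under the product integral.**  If the integrand is `ψ₁(U e₀ · X U) ψ₂((U e₀)⁻¹ · Y U) R U`
with `X, Y, R` not reading the coordinate `e₀` and `ψ₂` central, then integrating out `e₀` merges the two face
functions into `(ψ₁ ⋆ ψ₂)(Y U · X U)`. -/
theorem integral_glue_step (e₀ : ι) {ψ₁ ψ₂ : G → ℝ} (hψ₂z : ∀ g h, ψ₂ (h * g * h⁻¹) = ψ₂ g)
    {X Y : (ι → G) → G} {R : (ι → G) → ℝ} (hX : ∀ U g, X (update U e₀ g) = X U)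
    (hY : ∀ U g, Y (update U e₀ g) = Y U) (hR : ∀ U g, R (update U e₀ g) = R U)
    (hm : Measurable fun U : ι → G => ψ₁ (U e₀ * X U) * ψ₂ ((U e₀)⁻¹ * Y U) * R U) {C : ℝ}
    (hb : ∀ U : ι → G, |ψ₁ (U e₀ * X U) * ψ₂ ((U e₀)⁻¹ * Y U) * R U| ≤ C) :
    ∫ U, ψ₁ (U e₀ * X U) * ψ₂ ((U e₀)⁻¹ * Y U) * R U ∂(Measure.pi fun _ : ι => haarProbability G) =
      ∫ U, haarConv ψ₁ ψ₂ (Y U * X U) * R U ∂(Measure.pi fun _ : ι => haarProbability G) := by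
  rw [integral_pi_eq_integral_integral_update e₀ hm hb]
  refine integral_congr_ae (Eventually.of_forall fun U => ?_)
  dsimp only
  simp only [update_self, hX, hY, hR]
  rw [integral_mul_const, integral_mul_glue hψ₂z]

/-! ## §4 The cube -/

/-- **The cube integral is the six-fold convolution power at the identity.**  Twelve distinct coordinates
`e 0, …, e 11` of `ι → G` carry the edges of the unit cube between two facing plaquettes: bottom spatial edges
`a₁ … a₄ = e 0 … e 3`, top spatial edges `b₁ … b₄ = e 4 … e 7`, timelike edges `c₀, c₁, c₂, c₁₂ = e 8 … e 11`; the six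
face words are exactly the plaquette holonomies `U(x,i) U(x+eᵢ,j) U(x+eⱼ,i)⁻¹ U(x,j)⁻¹` of the bottom and top
plaquettes (plane `(1,2)`) and of the four lateral plaquettes (planes `(0,1)`, `(0,2)`).  For a continuous real class
function `φ` with `φ(g⁻¹) = φ(g)`:  `∫ ∏_{faces} φ(hol_f) dπ = φ^{*6}(1) = ((haarConv φ)^[5] φ) 1`. -/
theorem integral_cube_eq [T2Space G] {φ : G → ℝ} (hφc : Continuous φ) (hφz : ∀ g h, φ (h * g * h⁻¹) = φ g)
    (hφs : ∀ g, φ g⁻¹ = φ g) (e : Fin 12 → ι) (he : Injective e) :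
    ∫ U, φ (U (e 0) * U (e 1) * (U (e 2))⁻¹ * (U (e 3))⁻¹) *
        φ (U (e 4) * U (e 5) * (U (e 6))⁻¹ * (U (e 7))⁻¹) *
        φ (U (e 8) * U (e 4) * (U (e 9))⁻¹ * (U (e 0))⁻¹) *
        φ (U (e 10) * U (e 6) * (U (e 11))⁻¹ * (U (e 2))⁻¹) *
        φ (U (e 8) * U (e 7) * (U (e 10))⁻¹ * (U (e 3))⁻¹) *
        φ (U (e 9) * U (e 5) * (U (e 11))⁻¹ * (U (e 1))⁻¹)
        ∂(Measure.pi fun _ : ι => haarProbability G) = ((haarConv φ)^[5] φ) 1 := by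
  set π : Measure (ι → G) := Measure.pi fun _ : ι => haarProbability G with hπ
  -- the convolution powers and their invariances
  have hψc : ∀ n, Continuous ((haarConv φ)^[n] φ) := continuous_convIter hφc
  have hψz : ∀ n (g h : G), ((haarConv φ)^[n] φ) (h * g * h⁻¹) = ((haarConv φ)^[n] φ) g :=
    convIter_central hφz
  have cyc : ∀ n (x y : G), ((haarConv φ)^[n] φ) (x * y) = ((haarConv φ)^[n] φ) (y * x) :=
    fun n => apply_mul_comm_of_central (hψz n)
  have cyc0 : ∀ x y : G, φ (x * y) = φ (y * x) := apply_mul_comm_of_central hφz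
  have hφm : Measurable φ := hφc.measurable
  have hψm : ∀ n, Measurable ((haarConv φ)^[n] φ) := fun n => (hψc n).measurable
  -- coordinates not touched by an update
  have hupd : ∀ (U : ι → G) (i : Fin 12) (g : G) (j : Fin 12),
      update U (e i) g (e j) = if j = i then g else U (e j) := by
    intro U i g j
    by_cases h : j = i
    · subst h; simp
    · simp [h, he.ne h]
  -- power law: `ψ₄ ⋆ φ = ψ₅`, `ψ₅ ⋆ φ = ψ₆`, `φ ⋆ ψₙ = ψₙ₊₁`
  have hpow : ∀ m, haarConv ((haarConv φ)^[m] φ) φ = (haarConv φ)^[m + 1] φ := by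
    intro m
    have h := convIter_add φ hφc m 0
    simpa using h.symm
  have hsucc : ∀ m, haarConv φ ((haarConv φ)^[m] φ) = (haarConv φ)^[m + 1] φ :=
    fun m => (convIter_succ φ m).symm
  ---------------------------------------------------------------- step 1: glue `c₀ = e 8`
  have step1 : ∫ U, φ (U (e 0) * U (e 1) * (U (e 2))⁻¹ * (U (e 3))⁻¹) *
        φ (U (e 4) * U (e 5) * (U (e 6))⁻¹ * (U (e 7))⁻¹) *
        φ (U (e 8) * U (e 4) * (U (e 9))⁻¹ * (U (e 0))⁻¹) *
        φ (U (e 10) * U (e 6) * (U (e 11))⁻¹ * (U (e 2))⁻¹) *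
        φ (U (e 8) * U (e 7) * (U (e 10))⁻¹ * (U (e 3))⁻¹) *
        φ (U (e 9) * U (e 5) * (U (e 11))⁻¹ * (U (e 1))⁻¹) ∂π =
      ∫ U, ((haarConv φ)^[1] φ) ((U (e 3) * U (e 10) * (U (e 7))⁻¹) * (U (e 4) * (U (e 9))⁻¹ * (U (e 0))⁻¹)) *
        (φ (U (e 0) * U (e 1) * (U (e 2))⁻¹ * (U (e 3))⁻¹) *
          φ (U (e 4) * U (e 5) * (U (e 6))⁻¹ * (U (e 7))⁻¹) *
          φ (U (e 10) * U (e 6) * (U (e 11))⁻¹ * (U (e 2))⁻¹) *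
          φ (U (e 9) * U (e 5) * (U (e 11))⁻¹ * (U (e 1))⁻¹)) ∂π := by
    have key : ∀ U : ι → G, φ (U (e 0) * U (e 1) * (U (e 2))⁻¹ * (U (e 3))⁻¹) *
        φ (U (e 4) * U (e 5) * (U (e 6))⁻¹ * (U (e 7))⁻¹) *
        φ (U (e 8) * U (e 4) * (U (e 9))⁻¹ * (U (e 0))⁻¹) *
        φ (U (e 10) * U (e 6) * (U (e 11))⁻¹ * (U (e 2))⁻¹) *
        φ (U (e 8) * U (e 7) * (U (e 10))⁻¹ * (U (e 3))⁻¹) *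
        φ (U (e 9) * U (e 5) * (U (e 11))⁻¹ * (U (e 1))⁻¹) =
        φ (U (e 8) * (U (e 4) * (U (e 9))⁻¹ * (U (e 0))⁻¹)) *
          φ ((U (e 8))⁻¹ * (U (e 3) * U (e 10) * (U (e 7))⁻¹)) *
          (φ (U (e 0) * U (e 1) * (U (e 2))⁻¹ * (U (e 3))⁻¹) *
            φ (U (e 4) * U (e 5) * (U (e 6))⁻¹ * (U (e 7))⁻¹) *
            φ (U (e 10) * U (e 6) * (U (e 11))⁻¹ * (U (e 2))⁻¹) *
            φ (U (e 9) * U (e 5) * (U (e 11))⁻¹ * (U (e 1))⁻¹)) := by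
      intro U
      have h1 : φ (U (e 8) * U (e 4) * (U (e 9))⁻¹ * (U (e 0))⁻¹) =
          φ (U (e 8) * (U (e 4) * (U (e 9))⁻¹ * (U (e 0))⁻¹)) := by simp only [mul_assoc]
      have h3 : φ (U (e 8) * U (e 7) * (U (e 10))⁻¹ * (U (e 3))⁻¹) =
          φ ((U (e 8))⁻¹ * (U (e 3) * U (e 10) * (U (e 7))⁻¹)) := by
        rw [← hφs (U (e 8) * U (e 7) * (U (e 10))⁻¹ * (U (e 3))⁻¹)]
        rw [show (U (e 8) * U (e 7) * (U (e 10))⁻¹ * (U (e 3))⁻¹)⁻¹ =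
          (U (e 3) * U (e 10) * (U (e 7))⁻¹) * (U (e 8))⁻¹ by group, cyc0]
      rw [h1, h3]; ring
    simp_rw [key]
    have hc : Continuous fun U : ι → G => φ (U (e 8) * (U (e 4) * (U (e 9))⁻¹ * (U (e 0))⁻¹)) *
          φ ((U (e 8))⁻¹ * (U (e 3) * U (e 10) * (U (e 7))⁻¹)) *
          (φ (U (e 0) * U (e 1) * (U (e 2))⁻¹ * (U (e 3))⁻¹) *
            φ (U (e 4) * U (e 5) * (U (e 6))⁻¹ * (U (e 7))⁻¹) *
            φ (U (e 10) * U (e 6) * (U (e 11))⁻¹ * (U (e 2))⁻¹) *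
            φ (U (e 9) * U (e 5) * (U (e 11))⁻¹ * (U (e 1))⁻¹)) := by fun_prop
    obtain ⟨C, hC⟩ := exists_bound_of_continuous hc
    rw [integral_glue_step (e 8) hφz (X := fun U => U (e 4) * (U (e 9))⁻¹ * (U (e 0))⁻¹)
      (Y := fun U => U (e 3) * U (e 10) * (U (e 7))⁻¹)
      (R := fun U => φ (U (e 0) * U (e 1) * (U (e 2))⁻¹ * (U (e 3))⁻¹) *
            φ (U (e 4) * U (e 5) * (U (e 6))⁻¹ * (U (e 7))⁻¹) *
            φ (U (e 10) * U (e 6) * (U (e 11))⁻¹ * (U (e 2))⁻¹) *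
            φ (U (e 9) * U (e 5) * (U (e 11))⁻¹ * (U (e 1))⁻¹))
      (fun U g => by simp [hupd]) (fun U g => by simp [hupd]) (fun U g => by simp [hupd]) hc.measurable hC]
    rfl
  ---------------------------------------------------------------- step 2: glue `c₁ = e 9`
  have step2 : ∫ U, ((haarConv φ)^[1] φ) ((U (e 3) * U (e 10) * (U (e 7))⁻¹) * (U (e 4) * (U (e 9))⁻¹ * (U (e 0))⁻¹)) *
        (φ (U (e 0) * U (e 1) * (U (e 2))⁻¹ * (U (e 3))⁻¹) *
          φ (U (e 4) * U (e 5) * (U (e 6))⁻¹ * (U (e 7))⁻¹) *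
          φ (U (e 10) * U (e 6) * (U (e 11))⁻¹ * (U (e 2))⁻¹) *
          φ (U (e 9) * U (e 5) * (U (e 11))⁻¹ * (U (e 1))⁻¹)) ∂π =
      ∫ U, ((haarConv φ)^[2] φ) (((U (e 0))⁻¹ * (U (e 3) * U (e 10) * (U (e 7))⁻¹ * U (e 4))) * (U (e 5) * (U (e 11))⁻¹ * (U (e 1))⁻¹)) *
        (φ (U (e 0) * U (e 1) * (U (e 2))⁻¹ * (U (e 3))⁻¹) *
          φ (U (e 4) * U (e 5) * (U (e 6))⁻¹ * (U (e 7))⁻¹) *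
          φ (U (e 10) * U (e 6) * (U (e 11))⁻¹ * (U (e 2))⁻¹)) ∂π := by
    have key : ∀ U : ι → G, ((haarConv φ)^[1] φ) ((U (e 3) * U (e 10) * (U (e 7))⁻¹) * (U (e 4) * (U (e 9))⁻¹ * (U (e 0))⁻¹)) *
        (φ (U (e 0) * U (e 1) * (U (e 2))⁻¹ * (U (e 3))⁻¹) *
          φ (U (e 4) * U (e 5) * (U (e 6))⁻¹ * (U (e 7))⁻¹) *
          φ (U (e 10) * U (e 6) * (U (e 11))⁻¹ * (U (e 2))⁻¹) *
          φ (U (e 9) * U (e 5) * (U (e 11))⁻¹ * (U (e 1))⁻¹)) =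
        φ (U (e 9) * (U (e 5) * (U (e 11))⁻¹ * (U (e 1))⁻¹)) *
          ((haarConv φ)^[1] φ) ((U (e 9))⁻¹ * ((U (e 0))⁻¹ * (U (e 3) * U (e 10) * (U (e 7))⁻¹ * U (e 4)))) *
          (φ (U (e 0) * U (e 1) * (U (e 2))⁻¹ * (U (e 3))⁻¹) *
          φ (U (e 4) * U (e 5) * (U (e 6))⁻¹ * (U (e 7))⁻¹) *
          φ (U (e 10) * U (e 6) * (U (e 11))⁻¹ * (U (e 2))⁻¹)) := by
      intro U
      have h1 : φ (U (e 9) * U (e 5) * (U (e 11))⁻¹ * (U (e 1))⁻¹) = φ (U (e 9) * (U (e 5) * (U (e 11))⁻¹ * (U (e 1))⁻¹)) := by simp only [mul_assoc]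
      have h2 : ((haarConv φ)^[1] φ) ((U (e 3) * U (e 10) * (U (e 7))⁻¹) * (U (e 4) * (U (e 9))⁻¹ * (U (e 0))⁻¹)) = ((haarConv φ)^[1] φ) ((U (e 9))⁻¹ * ((U (e 0))⁻¹ * (U (e 3) * U (e 10) * (U (e 7))⁻¹ * U (e 4)))) := by
        rw [show (U (e 3) * U (e 10) * (U (e 7))⁻¹) * (U (e 4) * (U (e 9))⁻¹ * (U (e 0))⁻¹) = (U (e 3) * U (e 10) * (U (e 7))⁻¹ * U (e 4)) * ((U (e 9))⁻¹ * (U (e 0))⁻¹) by group, cyc 1]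
        group
      rw [h1, h2]; ring
    simp_rw [key]
    have hc : Continuous fun U : ι → G => φ (U (e 9) * (U (e 5) * (U (e 11))⁻¹ * (U (e 1))⁻¹)) *
          ((haarConv φ)^[1] φ) ((U (e 9))⁻¹ * ((U (e 0))⁻¹ * (U (e 3) * U (e 10) * (U (e 7))⁻¹ * U (e 4)))) *
          (φ (U (e 0) * U (e 1) * (U (e 2))⁻¹ * (U (e 3))⁻¹) *
          φ (U (e 4) * U (e 5) * (U (e 6))⁻¹ * (U (e 7))⁻¹) *
          φ (U (e 10) * U (e 6) * (U (e 11))⁻¹ * (U (e 2))⁻¹)) := by fun_prop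
    obtain ⟨C, hC⟩ := exists_bound_of_continuous hc
    rw [integral_glue_step (e 9) (hψz 1) (X := fun U => U (e 5) * (U (e 11))⁻¹ * (U (e 1))⁻¹)
      (Y := fun U => (U (e 0))⁻¹ * (U (e 3) * U (e 10) * (U (e 7))⁻¹ * U (e 4)))
      (R := fun U => (φ (U (e 0) * U (e 1) * (U (e 2))⁻¹ * (U (e 3))⁻¹) *
          φ (U (e 4) * U (e 5) * (U (e 6))⁻¹ * (U (e 7))⁻¹) *
          φ (U (e 10) * U (e 6) * (U (e 11))⁻¹ * (U (e 2))⁻¹)))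
      (fun U g => by simp [hupd]) (fun U g => by simp [hupd]) (fun U g => by simp [hupd]) hc.measurable hC]
    rfl
  ---------------------------------------------------------------- step 3: glue `a₁ = e 0`
  have step3 : ∫ U, ((haarConv φ)^[2] φ) (((U (e 0))⁻¹ * (U (e 3) * U (e 10) * (U (e 7))⁻¹ * U (e 4))) * (U (e 5) * (U (e 11))⁻¹ * (U (e 1))⁻¹)) *
        (φ (U (e 0) * U (e 1) * (U (e 2))⁻¹ * (U (e 3))⁻¹) *
          φ (U (e 4) * U (e 5) * (U (e 6))⁻¹ * (U (e 7))⁻¹) *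
          φ (U (e 10) * U (e 6) * (U (e 11))⁻¹ * (U (e 2))⁻¹)) ∂π =
      ∫ U, ((haarConv φ)^[3] φ) (U (e 10) * (U (e 7))⁻¹ * U (e 4) * U (e 5) * (U (e 11))⁻¹ * (U (e 2))⁻¹) *
        (φ (U (e 4) * U (e 5) * (U (e 6))⁻¹ * (U (e 7))⁻¹) *
          φ (U (e 10) * U (e 6) * (U (e 11))⁻¹ * (U (e 2))⁻¹)) ∂π := by
    have key : ∀ U : ι → G, ((haarConv φ)^[2] φ) (((U (e 0))⁻¹ * (U (e 3) * U (e 10) * (U (e 7))⁻¹ * U (e 4))) * (U (e 5) * (U (e 11))⁻¹ * (U (e 1))⁻¹)) *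
        (φ (U (e 0) * U (e 1) * (U (e 2))⁻¹ * (U (e 3))⁻¹) *
          φ (U (e 4) * U (e 5) * (U (e 6))⁻¹ * (U (e 7))⁻¹) *
          φ (U (e 10) * U (e 6) * (U (e 11))⁻¹ * (U (e 2))⁻¹)) =
        φ (U (e 0) * (U (e 1) * (U (e 2))⁻¹ * (U (e 3))⁻¹)) *
          ((haarConv φ)^[2] φ) ((U (e 0))⁻¹ * ((U (e 3) * U (e 10) * (U (e 7))⁻¹ * U (e 4)) * (U (e 5) * (U (e 11))⁻¹ * (U (e 1))⁻¹))) *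
          (φ (U (e 4) * U (e 5) * (U (e 6))⁻¹ * (U (e 7))⁻¹) *
          φ (U (e 10) * U (e 6) * (U (e 11))⁻¹ * (U (e 2))⁻¹)) := by
      intro U
      have h1 : φ (U (e 0) * U (e 1) * (U (e 2))⁻¹ * (U (e 3))⁻¹) = φ (U (e 0) * (U (e 1) * (U (e 2))⁻¹ * (U (e 3))⁻¹)) := by simp only [mul_assoc]
      have h2 : ((haarConv φ)^[2] φ) (((U (e 0))⁻¹ * (U (e 3) * U (e 10) * (U (e 7))⁻¹ * U (e 4))) * (U (e 5) * (U (e 11))⁻¹ * (U (e 1))⁻¹)) = ((haarConv φ)^[2] φ) ((U (e 0))⁻¹ * ((U (e 3) * U (e 10) * (U (e 7))⁻¹ * U (e 4)) * (U (e 5) * (U (e 11))⁻¹ * (U (e 1))⁻¹))) := by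
        group
      rw [h1, h2]; ring
    simp_rw [key]
    have hc : Continuous fun U : ι → G => φ (U (e 0) * (U (e 1) * (U (e 2))⁻¹ * (U (e 3))⁻¹)) *
          ((haarConv φ)^[2] φ) ((U (e 0))⁻¹ * ((U (e 3) * U (e 10) * (U (e 7))⁻¹ * U (e 4)) * (U (e 5) * (U (e 11))⁻¹ * (U (e 1))⁻¹))) *
          (φ (U (e 4) * U (e 5) * (U (e 6))⁻¹ * (U (e 7))⁻¹) *
          φ (U (e 10) * U (e 6) * (U (e 11))⁻¹ * (U (e 2))⁻¹)) := by fun_prop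
    obtain ⟨C, hC⟩ := exists_bound_of_continuous hc
    rw [integral_glue_step (e 0) (hψz 2) (X := fun U => U (e 1) * (U (e 2))⁻¹ * (U (e 3))⁻¹)
      (Y := fun U => (U (e 3) * U (e 10) * (U (e 7))⁻¹ * U (e 4)) * (U (e 5) * (U (e 11))⁻¹ * (U (e 1))⁻¹))
      (R := fun U => (φ (U (e 4) * U (e 5) * (U (e 6))⁻¹ * (U (e 7))⁻¹) *
          φ (U (e 10) * U (e 6) * (U (e 11))⁻¹ * (U (e 2))⁻¹)))
      (fun U g => by simp [hupd]) (fun U g => by simp [hupd]) (fun U g => by simp [hupd]) hc.measurable hC]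
    refine integral_congr_ae (Eventually.of_forall fun U => ?_)
    show haarConv φ ((haarConv φ)^[2] φ) (((U (e 3) * U (e 10) * (U (e 7))⁻¹ * U (e 4)) * (U (e 5) * (U (e 11))⁻¹ * (U (e 1))⁻¹)) * (U (e 1) * (U (e 2))⁻¹ * (U (e 3))⁻¹)) * (φ (U (e 4) * U (e 5) * (U (e 6))⁻¹ * (U (e 7))⁻¹) *
          φ (U (e 10) * U (e 6) * (U (e 11))⁻¹ * (U (e 2))⁻¹)) = ((haarConv φ)^[3] φ) (U (e 10) * (U (e 7))⁻¹ * U (e 4) * U (e 5) * (U (e 11))⁻¹ * (U (e 2))⁻¹) *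
        (φ (U (e 4) * U (e 5) * (U (e 6))⁻¹ * (U (e 7))⁻¹) *
          φ (U (e 10) * U (e 6) * (U (e 11))⁻¹ * (U (e 2))⁻¹))
    congr 1
    rw [hsucc 2, show ((U (e 3) * U (e 10) * (U (e 7))⁻¹ * U (e 4)) * (U (e 5) * (U (e 11))⁻¹ * (U (e 1))⁻¹)) * (U (e 1) * (U (e 2))⁻¹ * (U (e 3))⁻¹) =
      U (e 3) * (U (e 10) * (U (e 7))⁻¹ * U (e 4) * U (e 5) * (U (e 11))⁻¹ * (U (e 2))⁻¹) * (U (e 3))⁻¹ by group, hψz 3]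
  ---------------------------------------------------------------- step 4: glue `c₂ = e 10`
  have step4 : ∫ U, ((haarConv φ)^[3] φ) (U (e 10) * (U (e 7))⁻¹ * U (e 4) * U (e 5) * (U (e 11))⁻¹ * (U (e 2))⁻¹) *
        (φ (U (e 4) * U (e 5) * (U (e 6))⁻¹ * (U (e 7))⁻¹) *
          φ (U (e 10) * U (e 6) * (U (e 11))⁻¹ * (U (e 2))⁻¹)) ∂π =
      ∫ U, ((haarConv φ)^[4] φ) ((U (e 6))⁻¹ * (U (e 7))⁻¹ * U (e 4) * U (e 5)) *
        φ (U (e 4) * U (e 5) * (U (e 6))⁻¹ * (U (e 7))⁻¹) ∂π := by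
    have key : ∀ U : ι → G, ((haarConv φ)^[3] φ) (U (e 10) * (U (e 7))⁻¹ * U (e 4) * U (e 5) * (U (e 11))⁻¹ * (U (e 2))⁻¹) *
        (φ (U (e 4) * U (e 5) * (U (e 6))⁻¹ * (U (e 7))⁻¹) *
          φ (U (e 10) * U (e 6) * (U (e 11))⁻¹ * (U (e 2))⁻¹)) =
        ((haarConv φ)^[3] φ) (U (e 10) * ((U (e 7))⁻¹ * U (e 4) * U (e 5) * (U (e 11))⁻¹ * (U (e 2))⁻¹)) *
          φ ((U (e 10))⁻¹ * (U (e 2) * U (e 11) * (U (e 6))⁻¹)) *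
          φ (U (e 4) * U (e 5) * (U (e 6))⁻¹ * (U (e 7))⁻¹) := by
      intro U
      have h1 : ((haarConv φ)^[3] φ) (U (e 10) * (U (e 7))⁻¹ * U (e 4) * U (e 5) * (U (e 11))⁻¹ * (U (e 2))⁻¹) = ((haarConv φ)^[3] φ) (U (e 10) * ((U (e 7))⁻¹ * U (e 4) * U (e 5) * (U (e 11))⁻¹ * (U (e 2))⁻¹)) := by
        group
      have h2 : φ (U (e 10) * U (e 6) * (U (e 11))⁻¹ * (U (e 2))⁻¹) = φ ((U (e 10))⁻¹ * (U (e 2) * U (e 11) * (U (e 6))⁻¹)) := by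
        rw [← hφs (U (e 10) * U (e 6) * (U (e 11))⁻¹ * (U (e 2))⁻¹)]
        rw [show (U (e 10) * U (e 6) * (U (e 11))⁻¹ * (U (e 2))⁻¹)⁻¹ = (U (e 2) * U (e 11) * (U (e 6))⁻¹) * (U (e 10))⁻¹ by group, cyc0]
      rw [h1, h2]; ring
    simp_rw [key]
    have hc : Continuous fun U : ι → G => ((haarConv φ)^[3] φ) (U (e 10) * ((U (e 7))⁻¹ * U (e 4) * U (e 5) * (U (e 11))⁻¹ * (U (e 2))⁻¹)) *
          φ ((U (e 10))⁻¹ * (U (e 2) * U (e 11) * (U (e 6))⁻¹)) *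
          φ (U (e 4) * U (e 5) * (U (e 6))⁻¹ * (U (e 7))⁻¹) := by fun_prop
    obtain ⟨C, hC⟩ := exists_bound_of_continuous hc
    rw [integral_glue_step (e 10) hφz (X := fun U => (U (e 7))⁻¹ * U (e 4) * U (e 5) * (U (e 11))⁻¹ * (U (e 2))⁻¹)
      (Y := fun U => U (e 2) * U (e 11) * (U (e 6))⁻¹)
      (R := fun U => φ (U (e 4) * U (e 5) * (U (e 6))⁻¹ * (U (e 7))⁻¹))
      (fun U g => by simp [hupd]) (fun U g => by simp [hupd]) (fun U g => by simp [hupd]) hc.measurable hC]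
    refine integral_congr_ae (Eventually.of_forall fun U => ?_)
    show haarConv ((haarConv φ)^[3] φ) φ ((U (e 2) * U (e 11) * (U (e 6))⁻¹) * ((U (e 7))⁻¹ * U (e 4) * U (e 5) * (U (e 11))⁻¹ * (U (e 2))⁻¹)) * φ (U (e 4) * U (e 5) * (U (e 6))⁻¹ * (U (e 7))⁻¹) = ((haarConv φ)^[4] φ) ((U (e 6))⁻¹ * (U (e 7))⁻¹ * U (e 4) * U (e 5)) *
        φ (U (e 4) * U (e 5) * (U (e 6))⁻¹ * (U (e 7))⁻¹)
    congr 1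
    rw [hpow 3, show (U (e 2) * U (e 11) * (U (e 6))⁻¹) * ((U (e 7))⁻¹ * U (e 4) * U (e 5) * (U (e 11))⁻¹ * (U (e 2))⁻¹) =
      U (e 2) * (U (e 11) * ((U (e 6))⁻¹ * (U (e 7))⁻¹ * U (e 4) * U (e 5)) * (U (e 11))⁻¹) * (U (e 2))⁻¹ by group, hψz 4, hψz 4]
  ---------------------------------------------------------------- step 5: glue `b₁ = e 4`
  have step5 : ∫ U, ((haarConv φ)^[4] φ) ((U (e 6))⁻¹ * (U (e 7))⁻¹ * U (e 4) * U (e 5)) *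
        φ (U (e 4) * U (e 5) * (U (e 6))⁻¹ * (U (e 7))⁻¹) ∂π = ((haarConv φ)^[5] φ) 1 := by
    have key : ∀ U : ι → G, ((haarConv φ)^[4] φ) ((U (e 6))⁻¹ * (U (e 7))⁻¹ * U (e 4) * U (e 5)) *
        φ (U (e 4) * U (e 5) * (U (e 6))⁻¹ * (U (e 7))⁻¹) =
        ((haarConv φ)^[4] φ) (U (e 4) * (U (e 5) * (U (e 6))⁻¹ * (U (e 7))⁻¹)) *
          φ ((U (e 4))⁻¹ * (U (e 7) * U (e 6) * (U (e 5))⁻¹)) *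
          (1 : ℝ) := by
      intro U
      have h1 : ((haarConv φ)^[4] φ) ((U (e 6))⁻¹ * (U (e 7))⁻¹ * U (e 4) * U (e 5)) = ((haarConv φ)^[4] φ) (U (e 4) * (U (e 5) * (U (e 6))⁻¹ * (U (e 7))⁻¹)) := by
        rw [show (U (e 6))⁻¹ * (U (e 7))⁻¹ * U (e 4) * U (e 5) = ((U (e 6))⁻¹ * (U (e 7))⁻¹) * (U (e 4) * U (e 5)) by group, cyc 4]
        group
      have h2 : φ (U (e 4) * U (e 5) * (U (e 6))⁻¹ * (U (e 7))⁻¹) = φ ((U (e 4))⁻¹ * (U (e 7) * U (e 6) * (U (e 5))⁻¹)) := by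
        rw [← hφs (U (e 4) * U (e 5) * (U (e 6))⁻¹ * (U (e 7))⁻¹)]
        rw [show (U (e 4) * U (e 5) * (U (e 6))⁻¹ * (U (e 7))⁻¹)⁻¹ = (U (e 7) * U (e 6) * (U (e 5))⁻¹) * (U (e 4))⁻¹ by group, cyc0]
      rw [h1, h2, mul_one]
    simp_rw [key]
    have hc : Continuous fun U : ι → G => ((haarConv φ)^[4] φ) (U (e 4) * (U (e 5) * (U (e 6))⁻¹ * (U (e 7))⁻¹)) *
          φ ((U (e 4))⁻¹ * (U (e 7) * U (e 6) * (U (e 5))⁻¹)) *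
          (1 : ℝ) := by fun_prop
    obtain ⟨C, hC⟩ := exists_bound_of_continuous hc
    rw [integral_glue_step (e 4) hφz (X := fun U => U (e 5) * (U (e 6))⁻¹ * (U (e 7))⁻¹)
      (Y := fun U => U (e 7) * U (e 6) * (U (e 5))⁻¹)
      (R := fun _ => (1 : ℝ))
      (fun U g => by simp [hupd]) (fun U g => by simp [hupd]) (fun U g => rfl) hc.measurable hC]
    have hw : ∀ U : ι → G, haarConv ((haarConv φ)^[4] φ) φ ((U (e 7) * U (e 6) * (U (e 5))⁻¹) * (U (e 5) * (U (e 6))⁻¹ * (U (e 7))⁻¹)) * (1 : ℝ) = ((haarConv φ)^[5] φ) 1 := by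
      intro U
      rw [hpow 4, mul_one, show (U (e 7) * U (e 6) * (U (e 5))⁻¹) * (U (e 5) * (U (e 6))⁻¹ * (U (e 7))⁻¹) = (1 : G) by group]
    simp_rw [hw]
    simp [integral_const]
  rw [step1, step2, step3, step4, step5]

/-- **The cube integral is strictly positive** for a continuous real class function `φ ≢ 0` with `φ(g⁻¹) = φ(g)`:
`∫ ∏_{faces} φ(hol_f) dπ = φ^{*6}(1) = ‖φ^{*3}‖² > 0` (part 1, `convIter_five_apply_one_pos`). -/
theorem integral_cube_pos [T2Space G] {φ : G → ℝ} (hφc : Continuous φ) (hφz : ∀ g h, φ (h * g * h⁻¹) = φ g)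
    (hφs : ∀ g, φ g⁻¹ = φ g) (hφ0 : φ ≠ 0) (e : Fin 12 → ι) (he : Injective e) :
    0 < ∫ U, φ (U (e 0) * U (e 1) * (U (e 2))⁻¹ * (U (e 3))⁻¹) *
        φ (U (e 4) * U (e 5) * (U (e 6))⁻¹ * (U (e 7))⁻¹) *
        φ (U (e 8) * U (e 4) * (U (e 9))⁻¹ * (U (e 0))⁻¹) *
        φ (U (e 10) * U (e 6) * (U (e 11))⁻¹ * (U (e 2))⁻¹) *
        φ (U (e 8) * U (e 7) * (U (e 10))⁻¹ * (U (e 3))⁻¹) *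
        φ (U (e 9) * U (e 5) * (U (e 11))⁻¹ * (U (e 1))⁻¹)
        ∂(Measure.pi fun _ : ι => haarProbability G) := by
  rw [integral_cube_eq hφc hφz hφs e he]
  exact convIter_five_apply_one_pos hφc hφs hφ0

end Pi

end Summit.QuantumFields.YangMills.Cruxes.IR.SCFloor

end
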